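import Literature.MathematicalPhysics.QuantumFieldTheory.Balaban1983to89.B15Ineq146Proof
import Literature.MathematicalPhysics.QuantumFieldTheory.Balaban1983to89.B15Ineq196Proof

/-!
# `Balaban1983to89.B15Ineq191Lattice` — [Balaban1989LargeFieldI] p. 198 (1.91), p. 199 (1.95)–(1.96), p. 200 (1.98):
# *"Estimating as in (1.46) we get (1.91)"* KERNEL-CHECKED on the `ℤ^d` lattice carriers, and the chains (1.91) + (1.95)
# ⇒ (1.96) and (1.91)×2 + (1.80) ⇒ (1.98) END-TO-END from the printed representations and `ℍ`-bounds

statement-level skeleton of published theorems with citation tags; proofs where landed; nothing here is a claim about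
the Yang–Mills mass gap.

CITATION HEADER (lean-in-tree rule 2026-08-18).  T. Bałaban, *Large field renormalization. I. The basic step of the 𝐑
operation*, Commun. Math. Phys. **122**, 175–202 (1989), doi:10.1007/BF01257412, bib `Balaban1989LargeFieldI` (cell
paper B15; PDF held `paper:balaban1989-cmp122-large-field-i`, journal page = PDF page + 174; pp. 198–200 = PDF 24–26,
p. 186 = PDF 12, READ on the x2 renders `run/shared/lean/pub/pub-balaban/b2b-balaban-ref1/pages/1989-cmp122-large-field-I/
…-p024,p025,p026-x2.png` and the materialised OCR pages).  WHAT IS REPRODUCED: SKELETON rows `B15.Eq1.91`, `B15.Eq1.95`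
(first line), `B15.Eq1.96`, `B15.Eq1.98`, unit `lit-balaban-r12` gen 8 (reader/typer and fold owner of block B15,
Phase 2 in own block), HOME `run/shared/lean/pub/lit-balaban/` (`lit-balaban-r12/ROWS-B15.md`).  Used BY NAME, nothing
restated: p29's lattice mechanism of (1.46) `B15Ineq146Proof.mechanism_iEta` (for `U = (e^{isℍ}U₀)^{g}`:
`|U(∂p) − 1| ≤ |U₀(∂p) − 1| + s²|(D^s_{U₀}ℍ)(p)| + ½s²(Σ_{b⊂∂p}|ℍ(b)|)²`) and `norm_plaqCovDeriv_le`; r12's typed leaves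
`B15.PrelimIntegrations.Ineq191` ((1.91)), `Ineq195` ((1.95)); r12's arithmetic `B15Ineq196Proof.ineq196_of_191_195`
((1.96)), `ineq198` ((1.98)); the typed leaves `B15.BasicStep.Ineq196`, `B15.Ineq180` ((1.80), unit r2).

THE PRINTED TEXT (pp. 198–200, verbatim).  *"Take a cube □ ⊂ (Ω″^∼_{h+1})^c∩Ω_h, and represent the functions U″_{k,Z}
on □^∼ in the usual way: U″_{k,Z} = (exp iL^{k−h}ηℍ_{h,□}(−(1/i) log[M˙(U″_{k,Z})(M˙(Q^{s*}V″))⁻¹]) U_{h,□}(V″))^{u⁻¹_{h,□}}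
… (1.90)  The function ℍ_{h,□} and it[s] derivatives can be bounded on □^∼ by B₃exp(−δ2LM₂R_h)11d²ε_h <
11d²B₃exp(−R_h)ε_h < αε_h, where α is a small, absolute constant, which will be fixed later. Estimating as in (1.46) we
get |U″_{k,Z}(∂p) − 1| < |U_{h,□}(V″, ∂p) − 1|(1 + L^{−h}αε_h) + (α + 8α²ε_h)ε_h(L^{k−h}η)² for p ⊂ □^∼. (1.91)"*;
p. 198–199: *"Expanding U_{h,□}(V″) with respect to the above field, we get U_{h,□}(V″) = (exp iL^{k−h}ηℍ_{h,□}((1/i) log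
V″↾…) U_{h,□}(1, V_h))^{u′⁻¹_{h,□}}. (1.93) The function ℍ_{h,□} above, and its derivatives, can be bounded on □^∼ by … <
αε_h. (1.94) … From the representation (1.93) and the above bounds we get |U_{h,□}(V″, ∂p) − 1| < |U_{h,□}((1, V_h), ∂p)
− 1|(1 + L^{−h}αε_h) + (α + 8α²2ε_h)ε_h(L^{k−h}η)² < ½(1 + L^{−h}αε_h)ε_h(L^{k−h}η)² + (α + 8α²ε_h)ε_h(L^{k−h}η)². (1.95)
The estimates (1.91), (1.95) yield |U″_{k,Z}(∂p) − 1| < ¾ε_h(L^{k−h}η)² < (1 − β(1 − 2^{−(k−h+1)}))ε_h(L^{k−h}η)² (1.96) …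
We have chosen α = 1/12 in (1.91), (1.94), (1.95)."*; p. 199–200: *"This yields the bound (1.91) with h replaced by j, and
the configuration U_{h,□}(V″) replaced by (1.97). … The corresponding ℍ-function can be bounded … < αε_j. The plaquette
variables for the configuration (1.97) are bounded again as in (1.91), with h replaced by j, and with U_{h,□}(V″) replaced
by (1.97) for B′ = 0. This configuration is equal to U₀^{ū₀} … The plaquette variables of U₀^{ū₀} satisfy the estimate
(1.80). Combining the above estimates, and using the inequality ε_kη² ≤ … ≤ L^{−(k−j)}ε_j(L^{k−j}η)² for j < k, we obtain
[(1.98)]"*.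

WHAT IS PROVED (0 `sorry`, no `def`, no new `Prop`).  On the `ℤ^d` carriers of [14]/[12] (`B7Prop1Explicit`/`B8Ineq132`
dictionary, `𝔸` a C⋆-algebra, `U₀` and the gauge transformation `g` valued in `{|u| ≤ 1, |u⁻¹| ≤ 1}`, `ℍ` a self-adjoint
bond field — model (M1)–(M2) of `B15Ineq146Proof`), with `ξ > 0` the printed exponent scale `L^{k−h}η` of (1.90)/(1.93):
* `dev_le_of_bounds` — the (1.46) mechanism with UNIFORM bounds: `|ℍ(b)| ≤ Y` on the four bonds of `∂p` and
  `|(D^ξ_{U₀}ℍ)(p)| ≤ D` give `|U(∂p) − 1| ≤ |U₀(∂p) − 1| + (D + 8Y²)ξ²`; `dev_le_oneSup` (`D = Y`), `dev_le_twoSup`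
  (the two covariant derivatives `(∇^ξ_{U₀,μ}ℍ_ν)(x)`, `(∇^ξ_{U₀,ν}ℍ_μ)(x)` each `≤ Y` ⇒ `D = 2Y`, p29's instantiation of
  (1.45) in `ineq146_of_145`).
* `ineq191_lattice` — **(1.91) AS PRINTED**: *"ℍ_{h,□} and its derivatives … bounded on □^∼ by X < αε_h"* read as
  `|ℍ(b)| ≤ Y`, `|(D^ξℍ)(p)| ≤ Y`, `Y < αε_h` ⇒ r12's leaf `Ineq191 |U″(∂p) − 1| |U₀(∂p) − 1| α Linv ε_h (ε_hξ²)` for EVERY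
  `Linv ≥ 0` (print: `Linv = L^{−h}`; the printed factor `(1 + L^{−h}αε_h)` is slack — the mechanism has factor `1`);
  `ineq191_lattice_twoSup` — under the componentwise two-derivative reading the same with `α ↦ 2α`.  This is the kernel
  form of the cell's reading note GAPS G-B15-05 (rows `B15.Eq1.91`/`1.95`): the printed (1.91) HOLDS VERBATIM under the
  first reading; under the second its middle coefficient doubles (`α ≤ 1/24` instead of `1/12` downstream), nothing fails.
* `ineq195_lattice`, `ineq195_lattice_twoSup` — the same for the FIRST LINE of **(1.95)** (representation (1.93),
  `ℍ`-bound (1.94) `< αε_h`; print's additive coefficient `α + 8α²2ε_h` dominates the mechanism's `α + 8α²ε_h`).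
* `ineq196_lattice` — **(1.96) END-TO-END on the lattice**: the two representations (1.90), (1.93) as lattice data, the
  two `ℍ`-bounds `< αε_h` with the printed `α = 1/12`, the `χ_{h,1/2}`-restriction `|U_{h,□}((1,V_h), ∂p) − 1| <
  ½ε_h(L^{k−h}η)²` of (1.88), `β ≤ 1/4` (p. 198), `t = 2^{−(k−h+1)} ∈ (0, 1]`, and the implicit smallness `0 < ε_h ≤ 1/10`,
  `0 ≤ L^{−h} ≤ 1` ⇒ `Ineq196 |U″_{k,Z}(∂p) − 1| β t (ε_hξ²)`; `ineq196_lattice_twoSup` — idem under the second reading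
  with the `ℍ`-bounds `< (1/24)ε_h`.
* `ineq198_lattice` — **(1.98) END-TO-END on the lattice** (scale `j`, `ξ = L^{k−j}η`): the two (1.91)-shaped steps of
  p. 199 as lattice representations with `ℍ`-bounds `< αε_j`, (1.80) for `U₀^{ū₀}` (`B15.Ineq180`), the scale inequality
  `ε_kη² ≤ L^{−(k−j)}ε_j(L^{k−j}η)²`, `α ≤ 1/8`, `0 ≤ ε_j ≤ 1/10`, `0 ≤ L^{−j}, L^{−(k−j)} ≤ 1` ⇒ both printed lines of
  (1.98) (`B15Ineq196Proof.ineq198`, the *"increased O(1)"* explicit as `C(1 + L^{−j}αε_j)²`).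
READINGS DECLARED (referee columns F6/F7).  (R1) *"ℍ_{h,□} and its derivatives … bounded by X"*: `|ℍ(b)| ≤ X` bondwise
and, for the derivative, the plaquette covariant derivative in the unit of the exponent scale, `|(D^ξ_{U₀}ℍ)(p)| ≤ X`
(`D^ξ = ξ⁻¹·`covariant difference, `B8Eq146AExpansion.plaqCovDeriv ξ`) — the instantiation under which print's additive
constants `α + 8α²ε_h` come out EXACTLY (`ξ²·X + ½ξ²(4X)²`); (R2) the componentwise variant (two forward covariant
derivatives `∇^ξ_μℍ_ν`, `∇^ξ_νℍ_μ` each `≤ X`, (3.4) of [Balaban1985BackgroundPropagators]) doubles the middle coefficient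
(`_twoSup` theorems).  As in `B15Ineq146Proof` (M3), `|ℍ|(∂p)` is the sum over the four bonds of `∂p`; strictness `<` of
(1.91)/(1.95) comes from the strict `X < αε_h` and `ξ > 0`.

HONEST SCOPE.  The analytic inputs — the representations (1.90)/(1.93)/(1.97) themselves (existence of `ℍ_{h,□}`,
`u_{h,□}`: [15]) and the `ℍ`-bounds `< αε_h` ((1.90) chain, (1.94): [14]/[15] decay + the flow) — enter as lattice DATA
and HYPOTHESES of the printed shape; (1.80) is the typed leaf `B15.Ineq180` (proof deferred in print).  Units: the
conclusion is stated with `εE = ε_hξ²`, `ξ = L^{k−h}η` (print's `ε_h(L^{k−h}η)²`), cf. `ineq191_lattice_units`.  Value =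
the printed step *"Estimating as in (1.46)"* and the two closing chains as kernel-checked implications with the printed
constants; NOT summit progress.
-/

open scoped BigOperators
open NormedSpace Finset Complex

namespace Literature.MathematicalPhysics.QuantumFieldTheory.Balaban1983to89.B15Ineq191Lattice

open B7Prop1Explicit
open B8Lemma1NonAbelian (mulCfg)
open B8Ineq132 (plaqF covDerivFwd)
open B8Eq146AExpansion (plaqCovDeriv expCfg iEta)
open B15Ineq146Proof (mechanism_iEta norm_plaqCovDeriv_le)
open B15.PrelimIntegrations (Ineq191 Ineq195)
open B15.BasicStep (Ineq196)

-- `Site` alone could resolve to the torus sites of `Setup.lean` through a parent namespace; re-export the `ℤ^d`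
-- sites of `B7Prop1Explicit` (as in `B15Ineq146Proof`).
export B7Prop1Explicit (Site)

variable {d : ℕ} {𝔸 : Type*} [CStarAlgebra 𝔸] [Nontrivial 𝔸]

/-! ## §1. The (1.46) mechanism with uniform bounds on `ℍ` and its derivatives -/

/-- **The mechanism of (1.46) with uniform bounds** (p. 186 / p. 198 *"Estimating as in (1.46)"*): for `U = (e^{iξℍ}U₀)^{g}`
(`U₀`, `g` valued in `{|u| ≤ 1, |u⁻¹| ≤ 1}`, `ℍ` hermitian, `ξ > 0`), if `|ℍ(b)| ≤ Y` on the four bonds of `∂p` and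
`|(D^ξ_{U₀}ℍ)(p)| ≤ D`, then `|U(∂p) − 1| ≤ |U₀(∂p) − 1| + (D + 8Y²)ξ²` (from `mechanism_iEta`: the terms
`ξ²|(D^ξℍ)(p)| ≤ Dξ²` and `½ξ²(Σ_{b⊂∂p}|ℍ(b)|)² ≤ ½ξ²(4Y)² = 8Y²ξ²`). [cite: Balaban1989LargeFieldI, (1.46) p.186] -/
theorem dev_le_of_bounds {ξ : ℝ} (hξ : 0 < ξ) {U₀ : Site d → Fin d → 𝔸ˣ} (h₀ : ∀ y κ, U₀ y κ ∈ U1 𝔸)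
    {H : Site d → Fin d → 𝔸} (hH : ∀ y κ, IsSelfAdjoint (H y κ)) {g : Site d → 𝔸ˣ} (hg : ∀ y, g y ∈ U1 𝔸)
    (μ ν : Fin d) (x : Site d) {Y D : ℝ}
    (hH₁ : ‖H x μ‖ ≤ Y) (hH₂ : ‖H (x + e μ) ν‖ ≤ Y) (hH₃ : ‖H (x + e ν) μ‖ ≤ Y) (hH₄ : ‖H x ν‖ ≤ Y)
    (hDH : ‖plaqCovDeriv ξ U₀ H μ ν x‖ ≤ D) :
    ‖plaqF (gaugeAct g (mulCfg (expCfg (iEta ξ H)) U₀)) μ ν x - 1‖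
      ≤ ‖plaqF U₀ μ ν x - 1‖ + (D + 8 * Y ^ 2) * ξ ^ 2 := by
  have hmech := mechanism_iEta hξ h₀ hH hg μ ν x
  have hS : ‖H x μ‖ + ‖H (x + e μ) ν‖ + ‖H (x + e ν) μ‖ + ‖H x ν‖ ≤ 4 * Y := by linarith
  have hS0 : 0 ≤ ‖H x μ‖ + ‖H (x + e μ) ν‖ + ‖H (x + e ν) μ‖ + ‖H x ν‖ := by positivity
  have hT₂ : ξ ^ 2 * ‖plaqCovDeriv ξ U₀ H μ ν x‖ ≤ ξ ^ 2 * D := mul_le_mul_of_nonneg_left hDH (sq_nonneg _)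
  have hT₃ : (ξ * (‖H x μ‖ + ‖H (x + e μ) ν‖ + ‖H (x + e ν) μ‖ + ‖H x ν‖)) ^ 2 / 2 ≤ 8 * Y ^ 2 * ξ ^ 2 := by
    have h1 : (ξ * (‖H x μ‖ + ‖H (x + e μ) ν‖ + ‖H (x + e ν) μ‖ + ‖H x ν‖)) ^ 2 ≤ (ξ * (4 * Y)) ^ 2 :=
      pow_le_pow_left₀ (by positivity) (mul_le_mul_of_nonneg_left hS hξ.le) 2
    have h2 : (ξ * (4 * Y)) ^ 2 / 2 = 8 * Y ^ 2 * ξ ^ 2 := by ring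
    linarith
  have hring : ‖plaqF U₀ μ ν x - 1‖ + ξ ^ 2 * D + 8 * Y ^ 2 * ξ ^ 2
      = ‖plaqF U₀ μ ν x - 1‖ + (D + 8 * Y ^ 2) * ξ ^ 2 := by ring
  linarith

/-- The ONE-SUP reading of *"ℍ and its derivatives can be bounded by X"*: `|ℍ(b)| ≤ Y` (bonds of `∂p`) and
`|(D^ξ_{U₀}ℍ)(p)| ≤ Y` give `|U(∂p) − 1| ≤ |U₀(∂p) − 1| + (Y + 8Y²)ξ²` — print's additive constants `α + 8α²ε_h` of
(1.91) at `Y = αε_h`. [cite: Balaban1989LargeFieldI, (1.91) p.198] -/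
theorem dev_le_oneSup {ξ : ℝ} (hξ : 0 < ξ) {U₀ : Site d → Fin d → 𝔸ˣ} (h₀ : ∀ y κ, U₀ y κ ∈ U1 𝔸)
    {H : Site d → Fin d → 𝔸} (hH : ∀ y κ, IsSelfAdjoint (H y κ)) {g : Site d → 𝔸ˣ} (hg : ∀ y, g y ∈ U1 𝔸)
    (μ ν : Fin d) (x : Site d) {Y : ℝ}
    (hH₁ : ‖H x μ‖ ≤ Y) (hH₂ : ‖H (x + e μ) ν‖ ≤ Y) (hH₃ : ‖H (x + e ν) μ‖ ≤ Y) (hH₄ : ‖H x ν‖ ≤ Y)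
    (hDH : ‖plaqCovDeriv ξ U₀ H μ ν x‖ ≤ Y) :
    ‖plaqF (gaugeAct g (mulCfg (expCfg (iEta ξ H)) U₀)) μ ν x - 1‖
      ≤ ‖plaqF U₀ μ ν x - 1‖ + (Y + 8 * Y ^ 2) * ξ ^ 2 :=
  dev_le_of_bounds hξ h₀ hH hg μ ν x hH₁ hH₂ hH₃ hH₄ hDH

/-- The TWO-SUP (componentwise) reading, p29's instantiation of (1.45) in `B15Ineq146Proof.ineq146_of_145`: `|ℍ(b)| ≤ Y`
(bonds of `∂p`) and the two covariant derivatives `|(∇^ξ_{U₀,μ}ℍ_ν)(x)|, |(∇^ξ_{U₀,ν}ℍ_μ)(x)| ≤ Y` give, by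
`|(D^ξℍ)(p_{μν}(x))| ≤ |(∇_μℍ_ν)(x)| + |(∇_νℍ_μ)(x)|` ((3.4) of [Balaban1985BackgroundPropagators]),
`|U(∂p) − 1| ≤ |U₀(∂p) − 1| + (2Y + 8Y²)ξ²`. [cite: Balaban1989LargeFieldI, (1.46) p.186] -/
theorem dev_le_twoSup {ξ : ℝ} (hξ : 0 < ξ) {U₀ : Site d → Fin d → 𝔸ˣ} (h₀ : ∀ y κ, U₀ y κ ∈ U1 𝔸)
    {H : Site d → Fin d → 𝔸} (hH : ∀ y κ, IsSelfAdjoint (H y κ)) {g : Site d → 𝔸ˣ} (hg : ∀ y, g y ∈ U1 𝔸)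
    (μ ν : Fin d) (x : Site d) {Y : ℝ}
    (hH₁ : ‖H x μ‖ ≤ Y) (hH₂ : ‖H (x + e μ) ν‖ ≤ Y) (hH₃ : ‖H (x + e ν) μ‖ ≤ Y) (hH₄ : ‖H x ν‖ ≤ Y)
    (hDH₁ : ‖covDerivFwd ξ U₀ μ (fun y => H y ν) x‖ ≤ Y) (hDH₂ : ‖covDerivFwd ξ U₀ ν (fun y => H y μ) x‖ ≤ Y) :
    ‖plaqF (gaugeAct g (mulCfg (expCfg (iEta ξ H)) U₀)) μ ν x - 1‖
      ≤ ‖plaqF U₀ μ ν x - 1‖ + (2 * Y + 8 * Y ^ 2) * ξ ^ 2 := by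
  have hD : ‖plaqCovDeriv ξ U₀ H μ ν x‖ ≤ 2 * Y :=
    (norm_plaqCovDeriv_le ξ U₀ H μ ν x).trans (by linarith)
  exact dev_le_of_bounds hξ h₀ hH hg μ ν x hH₁ hH₂ hH₃ hH₄ hD

/-! ## §2. (1.91) p. 198 and the first line of (1.95) p. 199 on the lattice -/

/-- The strict arithmetic of the additive term: `0 ≤ Y < a` and `D ≤ cY`, `c ≥ 0` give `D + 8Y² < ca + 8a²`. [folklore] -/
private theorem addTerm_lt {Y D a c : ℝ} (hY0 : 0 ≤ Y) (hY : Y < a) (hD : D ≤ c * Y) (hc : 0 ≤ c) :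
    D + 8 * Y ^ 2 < c * a + 8 * a ^ 2 := by
  have h1 : c * Y ≤ c * a := mul_le_mul_of_nonneg_left hY.le hc
  have h2 : Y ^ 2 < a ^ 2 := by nlinarith
  linarith

/-- The common final step: `dev ≤ dev₀ + (D + 8Y²)ξ²` with `0 ≤ Y < αε`, `D ≤ cY` (`c ≥ 0`), `ξ > 0`, `ε ≥ 0`,
`dev₀ ≥ 0`, `Linv ≥ 0`, and an additive coefficient `K ≥ cα + 8α²ε` give `dev < dev₀(1 + Linv·(cα)·ε) + K·(εξ²)`. [folklore] -/
private theorem final_step {dev dev₀ D Y α ε ξ Linv c K : ℝ} (hle : dev ≤ dev₀ + (D + 8 * Y ^ 2) * ξ ^ 2)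
    (hY0 : 0 ≤ Y) (hY : Y < α * ε) (hD : D ≤ c * Y) (hc : 0 ≤ c) (hξ : 0 < ξ) (hε : 0 ≤ ε) (hdev₀ : 0 ≤ dev₀)
    (hLinv : 0 ≤ Linv) (hK : c * α + 8 * α ^ 2 * ε ≤ K) :
    dev < dev₀ * (1 + Linv * (c * α) * ε) + K * (ε * ξ ^ 2) := by
  have ha0 : 0 < α * ε := hY0.trans_lt hY
  have h1 := addTerm_lt hY0 hY hD hc
  have hξ2 : 0 < ξ ^ 2 := pow_pos hξ 2
  have h2 : (D + 8 * Y ^ 2) * ξ ^ 2 < (c * (α * ε) + 8 * (α * ε) ^ 2) * ξ ^ 2 := mul_lt_mul_of_pos_right h1 hξ2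
  have h3 : (c * (α * ε) + 8 * (α * ε) ^ 2) * ξ ^ 2 = (c * α + 8 * α ^ 2 * ε) * (ε * ξ ^ 2) := by ring
  have hεξ : 0 ≤ ε * ξ ^ 2 := by positivity
  have h4 : (c * α + 8 * α ^ 2 * ε) * (ε * ξ ^ 2) ≤ K * (ε * ξ ^ 2) := mul_le_mul_of_nonneg_right hK hεξ
  have hslack : 0 ≤ dev₀ * (Linv * (c * α) * ε) := by
    have e1 : Linv * (c * α) * ε = Linv * c * (α * ε) := by ring
    rw [e1]
    exact mul_nonneg hdev₀ (by positivity)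
  linarith

/-- **(1.91) p. 198 ON THE LATTICE, AS PRINTED.**  Data: `U₀ = U_{h,□}(V″)` and the gauge transformation `g = u⁻¹_{h,□}`
valued in `{|u| ≤ 1, |u⁻¹| ≤ 1}`, `ℍ = ℍ_{h,□}(−(1/i) log[…])` hermitian, `ξ = L^{k−h}η > 0`, `U″_{k,Z} = (e^{iξℍ}U₀)^{g}` (the
representation (1.90)); the printed bound *"ℍ_{h,□} and its derivatives can be bounded on □^∼ by X < αε_h"* read as
`|ℍ(b)| ≤ Y` on the bonds of `∂p`, `|(D^ξ_{U₀}ℍ)(p)| ≤ Y`, `Y < αε_h` (`ε_h ≥ 0`).  Conclusion: r12's typed leaf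
`Ineq191 |U″_{k,Z}(∂p) − 1| |U_{h,□}(V″,∂p) − 1| α Linv ε_h (ε_hξ²)`, i.e. *"|U″_{k,Z}(∂p) − 1| < |U_{h,□}(V″,∂p) − 1|(1 +
L^{−h}αε_h) + (α + 8α²ε_h)ε_h(L^{k−h}η)²"*, for EVERY `Linv ≥ 0` (print: `L^{−h}`): the mechanism gives the factor `1`, the
printed `(1 + L^{−h}αε_h)` is slack (cell reading note GAPS G-B15-05). [cite: Balaban1989LargeFieldI, (1.91) p.198] -/
theorem ineq191_lattice {ξ : ℝ} (hξ : 0 < ξ) {U₀ : Site d → Fin d → 𝔸ˣ} (h₀ : ∀ y κ, U₀ y κ ∈ U1 𝔸)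
    {H : Site d → Fin d → 𝔸} (hH : ∀ y κ, IsSelfAdjoint (H y κ)) {g : Site d → 𝔸ˣ} (hg : ∀ y, g y ∈ U1 𝔸)
    (μ ν : Fin d) (x : Site d) {Y α εh Linv : ℝ}
    (hH₁ : ‖H x μ‖ ≤ Y) (hH₂ : ‖H (x + e μ) ν‖ ≤ Y) (hH₃ : ‖H (x + e ν) μ‖ ≤ Y) (hH₄ : ‖H x ν‖ ≤ Y)
    (hDH : ‖plaqCovDeriv ξ U₀ H μ ν x‖ ≤ Y) (hY : Y < α * εh) (hε : 0 ≤ εh) (hLinv : 0 ≤ Linv) :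
    Ineq191 ‖plaqF (gaugeAct g (mulCfg (expCfg (iEta ξ H)) U₀)) μ ν x - 1‖ ‖plaqF U₀ μ ν x - 1‖ α Linv εh
      (εh * ξ ^ 2) := by
  unfold Ineq191
  have hY0 : 0 ≤ Y := (norm_nonneg _).trans hH₁
  have h := final_step (dev_le_oneSup hξ h₀ hH hg μ ν x hH₁ hH₂ hH₃ hH₄ hDH) hY0 hY
    (show Y ≤ 1 * Y by rw [one_mul]) zero_le_one hξ hε (norm_nonneg _) hLinv
    (le_refl (1 * α + 8 * α ^ 2 * εh))
  simpa only [one_mul] using h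

/-- **(1.91) under the two-sup reading** (the two covariant derivatives `(∇^ξ_{U₀,μ}ℍ_ν)(x)`, `(∇^ξ_{U₀,ν}ℍ_μ)(x)` each
`≤ Y < αε_h`, as p29 instantiates (1.45)): the leaf holds with `α ↦ 2α`, `Ineq191 … (2α) Linv ε_h (ε_hξ²)` — the *"worst
reading"* of the cell note GAPS G-B15-05 (downstream `α ≤ 1/24` instead of `1/12`); nothing in print fails. [cite: Balaban1989LargeFieldI, (1.91) p.198] -/
theorem ineq191_lattice_twoSup {ξ : ℝ} (hξ : 0 < ξ) {U₀ : Site d → Fin d → 𝔸ˣ} (h₀ : ∀ y κ, U₀ y κ ∈ U1 𝔸)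
    {H : Site d → Fin d → 𝔸} (hH : ∀ y κ, IsSelfAdjoint (H y κ)) {g : Site d → 𝔸ˣ} (hg : ∀ y, g y ∈ U1 𝔸)
    (μ ν : Fin d) (x : Site d) {Y α εh Linv : ℝ}
    (hH₁ : ‖H x μ‖ ≤ Y) (hH₂ : ‖H (x + e μ) ν‖ ≤ Y) (hH₃ : ‖H (x + e ν) μ‖ ≤ Y) (hH₄ : ‖H x ν‖ ≤ Y)
    (hDH₁ : ‖covDerivFwd ξ U₀ μ (fun y => H y ν) x‖ ≤ Y) (hDH₂ : ‖covDerivFwd ξ U₀ ν (fun y => H y μ) x‖ ≤ Y)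
    (hY : Y < α * εh) (hε : 0 ≤ εh) (hLinv : 0 ≤ Linv) :
    Ineq191 ‖plaqF (gaugeAct g (mulCfg (expCfg (iEta ξ H)) U₀)) μ ν x - 1‖ ‖plaqF U₀ μ ν x - 1‖ (2 * α) Linv εh
      (εh * ξ ^ 2) := by
  unfold Ineq191
  have hY0 : 0 ≤ Y := (norm_nonneg _).trans hH₁
  have hD : ‖plaqCovDeriv ξ U₀ H μ ν x‖ ≤ 2 * Y :=
    (norm_plaqCovDeriv_le ξ U₀ H μ ν x).trans (by linarith)
  have hK : 2 * α + 8 * α ^ 2 * εh ≤ 2 * α + 8 * (2 * α) ^ 2 * εh := by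
    nlinarith [mul_nonneg (sq_nonneg α) hε]
  have hle := dev_le_of_bounds hξ h₀ hH hg μ ν x hH₁ hH₂ hH₃ hH₄ hD
  exact final_step hle hY0 hY (le_refl (2 * Y)) (by norm_num) hξ hε (norm_nonneg _) hLinv hK

/-- **(1.95), FIRST LINE, p. 199 ON THE LATTICE** (one-sup reading, AS PRINTED up to print's larger coefficient).  Data:
`U₁ = U_{h,□}((1, V_h))`, `g = u′⁻¹_{h,□}`, `ℍ = ℍ_{h,□}((1/i) log V″↾…)` hermitian, `ξ = L^{k−h}η > 0`,
`U_{h,□}(V″) = (e^{iξℍ}U₁)^{g}` (the representation (1.93)); the bound (1.94) *"ℍ_{h,□} above, and its derivatives, can be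
bounded on □^∼ by … < αε_h"* read as `|ℍ(b)| ≤ Y`, `|(D^ξ_{U₁}ℍ)(p)| ≤ Y`, `Y < αε_h`.  Conclusion: r12's typed leaf
`Ineq195 |U_{h,□}(V″,∂p) − 1| |U_{h,□}((1,V_h),∂p) − 1| α Linv ε_h (ε_hξ²)`, i.e. the first printed inequality of (1.95)
with its coefficient `α + 8α²2ε_h` (the mechanism gives `α + 8α²ε_h ≤ α + 8α²2ε_h`), every `Linv ≥ 0`. [cite: Balaban1989LargeFieldI, (1.95) p.199] -/
theorem ineq195_lattice {ξ : ℝ} (hξ : 0 < ξ) {U₁ : Site d → Fin d → 𝔸ˣ} (h₁ : ∀ y κ, U₁ y κ ∈ U1 𝔸)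
    {H : Site d → Fin d → 𝔸} (hH : ∀ y κ, IsSelfAdjoint (H y κ)) {g : Site d → 𝔸ˣ} (hg : ∀ y, g y ∈ U1 𝔸)
    (μ ν : Fin d) (x : Site d) {Y α εh Linv : ℝ}
    (hH₁ : ‖H x μ‖ ≤ Y) (hH₂ : ‖H (x + e μ) ν‖ ≤ Y) (hH₃ : ‖H (x + e ν) μ‖ ≤ Y) (hH₄ : ‖H x ν‖ ≤ Y)
    (hDH : ‖plaqCovDeriv ξ U₁ H μ ν x‖ ≤ Y) (hY : Y < α * εh) (hε : 0 ≤ εh) (hLinv : 0 ≤ Linv) :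
    Ineq195 ‖plaqF (gaugeAct g (mulCfg (expCfg (iEta ξ H)) U₁)) μ ν x - 1‖ ‖plaqF U₁ μ ν x - 1‖ α Linv εh
      (εh * ξ ^ 2) := by
  unfold Ineq195
  have hY0 : 0 ≤ Y := (norm_nonneg _).trans hH₁
  have hK : 1 * α + 8 * α ^ 2 * εh ≤ α + 8 * α ^ 2 * 2 * εh := by
    nlinarith [mul_nonneg (sq_nonneg α) hε]
  have h := final_step (dev_le_oneSup hξ h₁ hH hg μ ν x hH₁ hH₂ hH₃ hH₄ hDH) hY0 hY
    (show Y ≤ 1 * Y by rw [one_mul]) zero_le_one hξ hε (norm_nonneg _) hLinv hK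
  simpa only [one_mul] using h

/-- **(1.95), first line, under the two-sup reading**: with the two covariant derivatives each `≤ Y < αε_h` the leaf holds
with `α ↦ 2α`. [cite: Balaban1989LargeFieldI, (1.95) p.199] -/
theorem ineq195_lattice_twoSup {ξ : ℝ} (hξ : 0 < ξ) {U₁ : Site d → Fin d → 𝔸ˣ} (h₁ : ∀ y κ, U₁ y κ ∈ U1 𝔸)
    {H : Site d → Fin d → 𝔸} (hH : ∀ y κ, IsSelfAdjoint (H y κ)) {g : Site d → 𝔸ˣ} (hg : ∀ y, g y ∈ U1 𝔸)
    (μ ν : Fin d) (x : Site d) {Y α εh Linv : ℝ}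
    (hH₁ : ‖H x μ‖ ≤ Y) (hH₂ : ‖H (x + e μ) ν‖ ≤ Y) (hH₃ : ‖H (x + e ν) μ‖ ≤ Y) (hH₄ : ‖H x ν‖ ≤ Y)
    (hDH₁ : ‖covDerivFwd ξ U₁ μ (fun y => H y ν) x‖ ≤ Y) (hDH₂ : ‖covDerivFwd ξ U₁ ν (fun y => H y μ) x‖ ≤ Y)
    (hY : Y < α * εh) (hε : 0 ≤ εh) (hLinv : 0 ≤ Linv) :
    Ineq195 ‖plaqF (gaugeAct g (mulCfg (expCfg (iEta ξ H)) U₁)) μ ν x - 1‖ ‖plaqF U₁ μ ν x - 1‖ (2 * α) Linv εh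
      (εh * ξ ^ 2) := by
  unfold Ineq195
  have hY0 : 0 ≤ Y := (norm_nonneg _).trans hH₁
  have hD : ‖plaqCovDeriv ξ U₁ H μ ν x‖ ≤ 2 * Y :=
    (norm_plaqCovDeriv_le ξ U₁ H μ ν x).trans (by linarith)
  have hK : 2 * α + 8 * α ^ 2 * εh ≤ 2 * α + 8 * (2 * α) ^ 2 * 2 * εh := by
    nlinarith [mul_nonneg (sq_nonneg α) hε]
  have hle := dev_le_of_bounds hξ h₁ hH hg μ ν x hH₁ hH₂ hH₃ hH₄ hD
  exact final_step hle hY0 hY (le_refl (2 * Y)) (by norm_num) hξ hε (norm_nonneg _) hLinv hK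

/-! ## §3. (1.96) p. 199 end-to-end on the lattice -/

/-- **(1.96) p. 199 END-TO-END ON THE LATTICE.**  Data on `□^∼` (scale `h`, `ξ = L^{k−h}η > 0`): the representation (1.90)
`U″_{k,Z} = (e^{iξℍ₁}U_{h,□}(V″))^{g₁}` with *"ℍ_{h,□} and its derivatives … bounded … by X < αε_h"* (`|ℍ₁(b)| ≤ Y₁`,
`|(D^ξℍ₁)(p)| ≤ Y₁`, `Y₁ < αε_h`); the representation (1.93) `U_{h,□}(V″) = (e^{iξℍ₂}U_{h,□}((1,V_h)))^{g₂}` with the bound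
(1.94) `< αε_h` (`Y₂`); the printed `α = 1/12`; the `χ_{h,1/2}`-restriction of (1.88) `|U_{h,□}((1,V_h), ∂p) − 1| <
½ε_h(L^{k−h}η)²`; *"We have assumed that β ≤ 1/4"* (p. 198); `t = 2^{−(k−h+1)} ∈ (0, 1]`; implicit smallness
`0 < ε_h ≤ 1/10`, `0 ≤ L^{−h} ≤ 1`.  Conclusion: the typed leaf `Ineq196 |U″_{k,Z}(∂p) − 1| β t (ε_hξ²)`, i.e.
*"|U″_{k,Z}(∂p) − 1| < ¾ε_h(L^{k−h}η)² < (1 − β(1 − 2^{−(k−h+1)}))ε_h(L^{k−h}η)²"* — via `ineq191_lattice`,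
`ineq195_lattice` and r12's `B15Ineq196Proof.ineq196_of_191_195`. [cite: Balaban1989LargeFieldI, (1.96) p.199] -/
theorem ineq196_lattice {ξ : ℝ} (hξ : 0 < ξ)
    {Uhb : Site d → Fin d → 𝔸ˣ} (hUhb : ∀ y κ, Uhb y κ ∈ U1 𝔸)
    {H₁ : Site d → Fin d → 𝔸} (hH₁sa : ∀ y κ, IsSelfAdjoint (H₁ y κ)) {g₁ : Site d → 𝔸ˣ} (hg₁ : ∀ y, g₁ y ∈ U1 𝔸)
    {U₁ : Site d → Fin d → 𝔸ˣ} (hU₁ : ∀ y κ, U₁ y κ ∈ U1 𝔸)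
    {H₂ : Site d → Fin d → 𝔸} (hH₂sa : ∀ y κ, IsSelfAdjoint (H₂ y κ)) {g₂ : Site d → 𝔸ˣ} (hg₂ : ∀ y, g₂ y ∈ U1 𝔸)
    (hrep : Uhb = gaugeAct g₂ (mulCfg (expCfg (iEta ξ H₂)) U₁))
    (μ ν : Fin d) (x : Site d) {Y₁ Y₂ α εh Linv β t : ℝ}
    (hA₁ : ‖H₁ x μ‖ ≤ Y₁) (hA₂ : ‖H₁ (x + e μ) ν‖ ≤ Y₁) (hA₃ : ‖H₁ (x + e ν) μ‖ ≤ Y₁) (hA₄ : ‖H₁ x ν‖ ≤ Y₁)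
    (hAD : ‖plaqCovDeriv ξ Uhb H₁ μ ν x‖ ≤ Y₁) (hY₁ : Y₁ < α * εh)
    (hB₁ : ‖H₂ x μ‖ ≤ Y₂) (hB₂ : ‖H₂ (x + e μ) ν‖ ≤ Y₂) (hB₃ : ‖H₂ (x + e ν) μ‖ ≤ Y₂) (hB₄ : ‖H₂ x ν‖ ≤ Y₂)
    (hBD : ‖plaqCovDeriv ξ U₁ H₂ μ ν x‖ ≤ Y₂) (hY₂ : Y₂ < α * εh)
    (hhalf : ‖plaqF U₁ μ ν x - 1‖ < 1 / 2 * (εh * ξ ^ 2)) (hα : α = 1 / 12) (hL0 : 0 ≤ Linv) (hL1 : Linv ≤ 1)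
    (hε0 : 0 < εh) (hε1 : εh ≤ 1 / 10) (hβ : β ≤ 1 / 4) (ht0 : 0 < t) (ht1 : t ≤ 1) :
    Ineq196 ‖plaqF (gaugeAct g₁ (mulCfg (expCfg (iEta ξ H₁)) Uhb)) μ ν x - 1‖ β t (εh * ξ ^ 2) := by
  have h191 := ineq191_lattice hξ hUhb hH₁sa hg₁ μ ν x hA₁ hA₂ hA₃ hA₄ hAD hY₁ hε0.le hL0
  have h195 := ineq195_lattice hξ hU₁ hH₂sa hg₂ μ ν x hB₁ hB₂ hB₃ hB₄ hBD hY₂ hε0.le hL0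
  rw [← hrep] at h195
  exact B15Ineq196Proof.ineq196_of_191_195 h191 h195 hhalf hα hL0 hL1 hε0.le hε1 (by positivity) hβ ht0 ht1

/-- **(1.96) under the two-sup reading**: the same end-to-end conclusion when the two `ℍ`-functions and their componentwise
covariant derivatives are bounded by `Y < (1/24)ε_h` (the leaves then hold with parameter `2·(1/24) = 1/12`, print's `α`).
[cite: Balaban1989LargeFieldI, (1.96) p.199] -/
theorem ineq196_lattice_twoSup {ξ : ℝ} (hξ : 0 < ξ)
    {Uhb : Site d → Fin d → 𝔸ˣ} (hUhb : ∀ y κ, Uhb y κ ∈ U1 𝔸)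
    {H₁ : Site d → Fin d → 𝔸} (hH₁sa : ∀ y κ, IsSelfAdjoint (H₁ y κ)) {g₁ : Site d → 𝔸ˣ} (hg₁ : ∀ y, g₁ y ∈ U1 𝔸)
    {U₁ : Site d → Fin d → 𝔸ˣ} (hU₁ : ∀ y κ, U₁ y κ ∈ U1 𝔸)
    {H₂ : Site d → Fin d → 𝔸} (hH₂sa : ∀ y κ, IsSelfAdjoint (H₂ y κ)) {g₂ : Site d → 𝔸ˣ} (hg₂ : ∀ y, g₂ y ∈ U1 𝔸)
    (hrep : Uhb = gaugeAct g₂ (mulCfg (expCfg (iEta ξ H₂)) U₁))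
    (μ ν : Fin d) (x : Site d) {Y₁ Y₂ α' εh Linv β t : ℝ}
    (hA₁ : ‖H₁ x μ‖ ≤ Y₁) (hA₂ : ‖H₁ (x + e μ) ν‖ ≤ Y₁) (hA₃ : ‖H₁ (x + e ν) μ‖ ≤ Y₁) (hA₄ : ‖H₁ x ν‖ ≤ Y₁)
    (hAD₁ : ‖covDerivFwd ξ Uhb μ (fun y => H₁ y ν) x‖ ≤ Y₁) (hAD₂ : ‖covDerivFwd ξ Uhb ν (fun y => H₁ y μ) x‖ ≤ Y₁)
    (hY₁ : Y₁ < α' * εh)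
    (hB₁ : ‖H₂ x μ‖ ≤ Y₂) (hB₂ : ‖H₂ (x + e μ) ν‖ ≤ Y₂) (hB₃ : ‖H₂ (x + e ν) μ‖ ≤ Y₂) (hB₄ : ‖H₂ x ν‖ ≤ Y₂)
    (hBD₁ : ‖covDerivFwd ξ U₁ μ (fun y => H₂ y ν) x‖ ≤ Y₂) (hBD₂ : ‖covDerivFwd ξ U₁ ν (fun y => H₂ y μ) x‖ ≤ Y₂)
    (hY₂ : Y₂ < α' * εh)
    (hhalf : ‖plaqF U₁ μ ν x - 1‖ < 1 / 2 * (εh * ξ ^ 2)) (hα' : α' = 1 / 24) (hL0 : 0 ≤ Linv) (hL1 : Linv ≤ 1)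
    (hε0 : 0 < εh) (hε1 : εh ≤ 1 / 10) (hβ : β ≤ 1 / 4) (ht0 : 0 < t) (ht1 : t ≤ 1) :
    Ineq196 ‖plaqF (gaugeAct g₁ (mulCfg (expCfg (iEta ξ H₁)) Uhb)) μ ν x - 1‖ β t (εh * ξ ^ 2) := by
  have h191 := ineq191_lattice_twoSup hξ hUhb hH₁sa hg₁ μ ν x hA₁ hA₂ hA₃ hA₄ hAD₁ hAD₂ hY₁ hε0.le hL0
  have h195 := ineq195_lattice_twoSup hξ hU₁ hH₂sa hg₂ μ ν x hB₁ hB₂ hB₃ hB₄ hBD₁ hBD₂ hY₂ hε0.le hL0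
  rw [← hrep] at h195
  have hα : 2 * α' = 1 / 12 := by rw [hα']; norm_num
  exact B15Ineq196Proof.ineq196_of_191_195 h191 h195 hhalf hα hL0 hL1 hε0.le hε1 (by positivity) hβ ht0 ht1

/-! ## §4. (1.98) p. 200 end-to-end on the lattice -/

/-- **(1.98) p. 200 END-TO-END ON THE LATTICE** (scale `j`, `ξ = L^{k−j}η > 0`).  Data: the two (1.91)-shaped steps of
p. 199 — `U″_{k,Z} = (e^{iξℍ₁}C)^{g₁}` against the configuration `C` = (1.97) (*"the ℍ-function … can be bounded … <
αε_j"*: `Y₁`), and `C = (e^{iξℍ₂}C₀)^{g₂}` against `C₀` = (1.97) at `B′ = 0` `= U₀^{ū₀}` (*"The corresponding ℍ-function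
can be bounded … < αε_j"*: `Y₂`), one-sup reading; (1.80) for the plaquette variables of `U₀^{ū₀}` (`B15.Ineq180 |C₀(∂p) −
1| ε_k η B₃ B₅ M δ dist(p,Λ) Cst`); the scale inequality *"ε_kη² ≤ … ≤ L^{−(k−j)}ε_j(L^{k−j}η)² for j < k"* (`e ≤
Lkj·(ε_jξ²)`, `Lkj ≤ 1`); p. 200 *"taking α ≤ 1/8"*; implicit smallness `0 ≤ ε_j ≤ 1/10`, `0 ≤ L^{−j} ≤ 1`, signs.
Conclusion: both printed lines of (1.98), `|U″_{k,Z}(∂p) − 1| < (2L^{−(k−j)} + 4α + Cst(1 + L^{−j}αε_j)²·B₃B₅M⁵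
e^{−δdist(p,Λ)}L^{−(k−j)})·ε_j(L^{k−j}η)²` (`B15Ineq196Proof.ineq198`, the *"increased O(1)"* explicit).
[cite: Balaban1989LargeFieldI, (1.98) p.200] -/
theorem ineq198_lattice {ξ : ℝ} (hξ : 0 < ξ)
    {C : Site d → Fin d → 𝔸ˣ} (hC : ∀ y κ, C y κ ∈ U1 𝔸)
    {H₁ : Site d → Fin d → 𝔸} (hH₁sa : ∀ y κ, IsSelfAdjoint (H₁ y κ)) {g₁ : Site d → 𝔸ˣ} (hg₁ : ∀ y, g₁ y ∈ U1 𝔸)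
    {C₀ : Site d → Fin d → 𝔸ˣ} (hC₀ : ∀ y κ, C₀ y κ ∈ U1 𝔸)
    {H₂ : Site d → Fin d → 𝔸} (hH₂sa : ∀ y κ, IsSelfAdjoint (H₂ y κ)) {g₂ : Site d → 𝔸ˣ} (hg₂ : ∀ y, g₂ y ∈ U1 𝔸)
    (hrep : C = gaugeAct g₂ (mulCfg (expCfg (iEta ξ H₂)) C₀))
    (μ ν : Fin d) (x : Site d) {Y₁ Y₂ α εj Linv εk η B₃ B₅ M δ dist Cst Lkj : ℝ}
    (hA₁ : ‖H₁ x μ‖ ≤ Y₁) (hA₂ : ‖H₁ (x + e μ) ν‖ ≤ Y₁) (hA₃ : ‖H₁ (x + e ν) μ‖ ≤ Y₁) (hA₄ : ‖H₁ x ν‖ ≤ Y₁)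
    (hAD : ‖plaqCovDeriv ξ C H₁ μ ν x‖ ≤ Y₁) (hY₁ : Y₁ < α * εj)
    (hB₁ : ‖H₂ x μ‖ ≤ Y₂) (hB₂ : ‖H₂ (x + e μ) ν‖ ≤ Y₂) (hB₃ : ‖H₂ (x + e ν) μ‖ ≤ Y₂) (hB₄ : ‖H₂ x ν‖ ≤ Y₂)
    (hBD : ‖plaqCovDeriv ξ C₀ H₂ μ ν x‖ ≤ Y₂) (hY₂ : Y₂ < α * εj)
    (h180 : B15.Ineq180 ‖plaqF C₀ μ ν x - 1‖ εk η B₃ B₅ M δ dist Cst)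
    (hα0 : 0 ≤ α) (hα : α ≤ 1 / 8) (hL0 : 0 ≤ Linv) (hL1 : Linv ≤ 1) (hε0 : 0 ≤ εj) (hε1 : εj ≤ 1 / 10)
    (hX : 0 ≤ Cst * B₃ * B₅ * M ^ 5 * Real.exp (-δ * dist)) (he : 0 ≤ εk * η ^ 2)
    (hscale : εk * η ^ 2 ≤ Lkj * (εj * ξ ^ 2)) (hLkj1 : Lkj ≤ 1) :
    ‖plaqF (gaugeAct g₁ (mulCfg (expCfg (iEta ξ H₁)) C)) μ ν x - 1‖
      < (2 * Lkj + 4 * α + Cst * (1 + Linv * α * εj) ^ 2 * B₃ * B₅ * M ^ 5 * Real.exp (-δ * dist) * Lkj)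
        * (εj * ξ ^ 2) := by
  have h1 := ineq191_lattice hξ hC hH₁sa hg₁ μ ν x hA₁ hA₂ hA₃ hA₄ hAD hY₁ hε0 hL0
  have h2 := ineq191_lattice hξ hC₀ hH₂sa hg₂ μ ν x hB₁ hB₂ hB₃ hB₄ hBD hY₂ hε0 hL0
  rw [← hrep] at h2
  exact B15Ineq196Proof.ineq198 h1 h2 h180 hα0 hα hL0 hL1 hε0 hε1 (by positivity) hX he hscale hLkj1

/-! ## §5. Units -/

/-- Units of (1.91): with `L ≥ 1`, `h ≤ k`, `η = L^{−k}` and `ξ = L^{k−h}η` one has `ξ = (L^h)⁻¹ = L^{−h}` and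
`ε_hξ² = ε_h(L^{k−h}η)²` — so `ineq191_lattice` at `Linv := ξ` is the leaf with print's `L^{−h}` in BOTH places.
[cite: Balaban1989LargeFieldI, (1.91) p.198] -/
theorem xi_eq_inv_pow {L : ℕ} (hL : 1 ≤ L) {h k : ℕ} (hhk : h ≤ k) {η ξ : ℝ} (hη : η = ((L : ℝ) ^ k)⁻¹)
    (hξ : ξ = (L : ℝ) ^ (k - h) * η) : ξ = ((L : ℝ) ^ h)⁻¹ ∧ 0 < ξ ∧ ξ ≤ 1 := by
  have hL0 : (0 : ℝ) < L := Nat.cast_pos.mpr (by omega)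
  have hL1 : (1 : ℝ) ≤ L := by exact_mod_cast hL
  have hLh : (0 : ℝ) < (L : ℝ) ^ h := pow_pos hL0 h
  have hval : ξ = ((L : ℝ) ^ h)⁻¹ := by
    have hk : (L : ℝ) ^ k = (L : ℝ) ^ (k - h) * (L : ℝ) ^ h := by
      rw [← pow_add, Nat.sub_add_cancel hhk]
    rw [hξ, hη, hk, mul_inv, ← mul_assoc, mul_inv_cancel₀ (pow_ne_zero _ hL0.ne'), one_mul]
  refine ⟨hval, ?_, ?_⟩
  · rw [hval]; exact inv_pos.mpr hLh
  · rw [hval]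
    exact inv_le_one_of_one_le₀ (one_le_pow₀ hL1)

/-- **(1.91) in print's units**: `η = L^{−k}`, `ξ = L^{k−h}η`, `h ≤ k`, `L ≥ 1` ⇒ `Ineq191 |U″(∂p) − 1| |U₀(∂p) − 1| α L^{−h}
ε_h (ε_h(L^{k−h}η)²)` with `L^{−h} = (L^h)⁻¹` in the factor AND `ε_h(L^{k−h}η)²` as the additive unit, from the one-sup
`ℍ`-bounds `< αε_h`. [cite: Balaban1989LargeFieldI, (1.91) p.198] -/
theorem ineq191_lattice_units {L : ℕ} (hL : 1 ≤ L) {h k : ℕ} (hhk : h ≤ k) {η ξ : ℝ} (hη : η = ((L : ℝ) ^ k)⁻¹)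
    (hξ : ξ = (L : ℝ) ^ (k - h) * η) {U₀ : Site d → Fin d → 𝔸ˣ} (h₀ : ∀ y κ, U₀ y κ ∈ U1 𝔸)
    {H : Site d → Fin d → 𝔸} (hH : ∀ y κ, IsSelfAdjoint (H y κ)) {g : Site d → 𝔸ˣ} (hg : ∀ y, g y ∈ U1 𝔸)
    (μ ν : Fin d) (x : Site d) {Y α εh : ℝ}
    (hH₁ : ‖H x μ‖ ≤ Y) (hH₂ : ‖H (x + e μ) ν‖ ≤ Y) (hH₃ : ‖H (x + e ν) μ‖ ≤ Y) (hH₄ : ‖H x ν‖ ≤ Y)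
    (hDH : ‖plaqCovDeriv ξ U₀ H μ ν x‖ ≤ Y) (hY : Y < α * εh) (hε : 0 ≤ εh) :
    Ineq191 ‖plaqF (gaugeAct g (mulCfg (expCfg (iEta ξ H)) U₀)) μ ν x - 1‖ ‖plaqF U₀ μ ν x - 1‖ α
      (((L : ℝ) ^ h)⁻¹) εh (εh * ((L : ℝ) ^ (k - h) * η) ^ 2) := by
  obtain ⟨hval, hpos, -⟩ := xi_eq_inv_pow hL hhk hη hξ
  rw [← hξ, ← hval]
  exact ineq191_lattice hpos h₀ hH hg μ ν x hH₁ hH₂ hH₃ hH₄ hDH hY hε hpos.le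

end Literature.MathematicalPhysics.QuantumFieldTheory.Balaban1983to89.B15Ineq191Lattice
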